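import Mathlib
import Summits.Ventures.PercRepro.TriangleCapStarFamilyExact
import Summits.Ventures.PercRepro.TriangleCapStarFamilyNecessityUpper

/-!
# PercRepro — THE THRESHOLD OF THE RESIDUE MINIMUM: ATTAINED IFF `m ≥ D + r − 1` (`2 ≤ r ≤ D / 2`) RESP.
`m ≥ D + r − 2` (`D < 2 r ≤ 2 D − 4`) (p3, gen 56; part 323)

On `ℓ + 1 + (s − t)` vertices, `t = m D + r`, `m + 1 ≤ ℓ`, `2 t ≤ s`: a graph of the band (triangle-free, `s` edges,
`w` of degree `s − t`, every off-degree `≤ D`) with the band value `2 j + 2 t (D − 1) = t (t − 1) + ` the residue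
minimum of part 312 exists IFF `D + r ≤ m + 1` when `2 ≤ r`, `2 r ≤ D` (`residue_min_attained_iff_half`: the star
family of part 319 and the strict bound of part 321), and IFF `D + r ≤ m + 2` when `D + 1 ≤ 2 r`, `r + 2 ≤ D`
(`residue_min_attained_iff_upper`: parts 319 and 322).  So the bottom of the deep sub-band `u = t − D` on all graphs
is `C(t,2) − t (D − 1) + min(r, D − r)(D − 2 min(r, D − r) + 1)` exactly from these thresholds on, and strictly larger
below them (where it lies between that value `+ 1` and the bipartite value `C(t,2) − t (D − 1) + r (D − r)` of
part 307).  Axioms: standard.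
-/

namespace PercRepro

namespace TriangleCap

namespace C047

open Finset

/-- **THE THRESHOLD FOR `2 ≤ r ≤ D / 2`:** the residue minimum `2 r (D − 2 r + 1)` is attained by a graph of the
band on `ℓ + 1 + (s − t)` vertices iff `m ≥ D + r − 1`. -/
theorem residue_min_attained_iff_half (s ℓ m r D : ℕ) (hr : 2 ≤ r) (h2 : 2 * r ≤ D) (hmℓ : m + 1 ≤ ℓ)
    (hs : 2 * (m * D + r) ≤ s) :
    (∃ (H : SimpleGraph (Fin (ℓ + 1 + (s - (m * D + r))))) (_ : DecidableRel H.Adj), H.CliqueFree 3 ∧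
      H.edgeFinset.card = s ∧ ∃ w, deg H w + (m * D + r) = s ∧ (∀ v, offDeg H w v ≤ D) ∧
        ∃ j, ∑ v, deg H v * deg H v + 2 * ((m * D + r) * (s - (m * D + r) - 1)) + 2 * j = s * (s + 1) ∧
          2 * j + 2 * ((m * D + r) * (D - 1)) = (m * D + r) * (m * D + r - 1) + 2 * (r * (D - 2 * r + 1))) ↔
    D + r ≤ m + 1 := by
  constructor
  · rintro ⟨H, _, hfree, hcard, w, hw, hD', j, hj, hval⟩
    by_contra hm
    rw [not_le] at hm
    have hw1 : 1 ≤ deg H w := by omega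
    have := else_bottom_strict_half H hfree s m r D j hr h2 (by omega) hcard w hw hw1 hj hD'
    omega
  · intro hm
    obtain ⟨H, inst, hfree, hcard, w, hw, hD', -, j, hj, hval⟩ :=
      (else_bottom_exact_half s ℓ m r D (by omega) h2 hm hmℓ hs).2
    exact ⟨H, inst, hfree, hcard, w, hw, hD', j, hj, hval⟩

/-- **THE THRESHOLD FOR `D < 2 r ≤ 2 D − 4`:** the residue minimum `2 ρ (D − 2 ρ + 1)`, `ρ = D − r`, is attained by
a graph of the band on `ℓ + 1 + (s − t)` vertices iff `m ≥ D + r − 2`. -/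
theorem residue_min_attained_iff_upper (s ℓ m r D : ℕ) (h1 : D + 1 ≤ 2 * r) (h2 : r + 2 ≤ D) (hmℓ : m + 1 ≤ ℓ)
    (hs : 2 * (m * D + r) ≤ s) :
    (∃ (H : SimpleGraph (Fin (ℓ + 1 + (s - (m * D + r))))) (_ : DecidableRel H.Adj), H.CliqueFree 3 ∧
      H.edgeFinset.card = s ∧ ∃ w, deg H w + (m * D + r) = s ∧ (∀ v, offDeg H w v ≤ D) ∧
        ∃ j, ∑ v, deg H v * deg H v + 2 * ((m * D + r) * (s - (m * D + r) - 1)) + 2 * j = s * (s + 1) ∧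
          2 * j + 2 * ((m * D + r) * (D - 1)) =
            (m * D + r) * (m * D + r - 1) + 2 * ((D - r) * (D - 2 * (D - r) + 1))) ↔
    D + r ≤ m + 2 := by
  constructor
  · rintro ⟨H, _, hfree, hcard, w, hw, hD', j, hj, hval⟩
    by_contra hm
    rw [not_le] at hm
    have hw1 : 1 ≤ deg H w := by omega
    have := else_bottom_strict_upper H hfree s m r D j h1 h2 (by omega) hcard w hw hw1 hj hD'
    omega
  · intro hm
    obtain ⟨H, inst, hfree, hcard, w, hw, hD', -, j, hj, hval⟩ :=
      (else_bottom_exact_upper s ℓ m r D h1 (by omega) hm hmℓ hs).2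
    exact ⟨H, inst, hfree, hcard, w, hw, hD', j, hj, hval⟩

/-- **THE THRESHOLD, UNIFIED (`2 ≤ r ≤ D − 2`):** the residue minimum `min(2 r (D − r), 2 min(r, D − r) + φ_D(2 r))`
of part 312 is attained by a graph of the band on `ℓ + 1 + (s − t)` vertices iff `m ≥ D + r − 1` when `2 r ≤ D`, and
iff `m ≥ D + r − 2` when `D < 2 r`. -/
theorem residue_min_attained_iff (s ℓ m r D : ℕ) (hr : 2 ≤ r) (hrD : r + 2 ≤ D) (hmℓ : m + 1 ≤ ℓ)
    (hs : 2 * (m * D + r) ≤ s) :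
    (∃ (H : SimpleGraph (Fin (ℓ + 1 + (s - (m * D + r))))) (_ : DecidableRel H.Adj), H.CliqueFree 3 ∧
      H.edgeFinset.card = s ∧ ∃ w, deg H w + (m * D + r) = s ∧ (∀ v, offDeg H w v ≤ D) ∧
        ∃ j, ∑ v, deg H v * deg H v + 2 * ((m * D + r) * (s - (m * D + r) - 1)) + 2 * j = s * (s + 1) ∧
          2 * j + 2 * ((m * D + r) * (D - 1)) = (m * D + r) * (m * D + r - 1) +
            min (2 * (r * (D - r))) (2 * min r (D - r) + phiD D (2 * r))) ↔
    ((2 * r ≤ D ∧ D + r ≤ m + 1) ∨ (D < 2 * r ∧ D + r ≤ m + 2)) := by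
  rcases Nat.lt_or_ge D (2 * r) with h | h
  · rw [residue_min_upper D r (by omega) (by omega), residue_min_attained_iff_upper s ℓ m r D (by omega) hrD hmℓ hs]
    constructor
    · intro hm
      exact Or.inr ⟨h, hm⟩
    · rintro (⟨h', -⟩ | ⟨-, hm⟩)
      · omega
      · exact hm
  · rw [residue_min_half D r (by omega) h, residue_min_attained_iff_half s ℓ m r D hr h hmℓ hs]
    constructor
    · intro hm
      exact Or.inl ⟨h, hm⟩
    · rintro (⟨-, hm⟩ | ⟨h', -⟩)
      · exact hm
      · omega

end C047

end TriangleCap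

end PercRepro
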